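import Summits.CriticalPhenomena.PercolationContinuityZ3.Theorems.PercNearOneGluingNoHeavyLowerTailCovTauA2Star
import Summits.CriticalPhenomena.PercolationContinuityZ3.Theorems.PercNearOneGluingNoHeavyLowerTailCovTauA2Push
import Mathlib.Combinatorics.SetFamily.FourFunctions
import HarnessLib

/-!
# Crux `NoHeavyLowerTail` (stmt-CriticalPhenomena-4575): the two-source inequality (A2) of the COV(τ) proof,
# modulo the one-source bound (★)

Support file (`--supports stmt-CriticalPhenomena-4575`, prover prim-hp-4 gen 9).  No named facts, no sorries, no
`Prop` definitions.  Continues `…CovTauA2Defs.lean` / `…CovTauA2Star.lean`.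

**Theorem `CovTau.a2_of_star`** (prim-hp-8's COV-TAU-PROOF §4, "Lemma A2", in the finite-sum framework of
`BHK2006.core`; percolation restricted to `U : Finset V`, owner `x`, observers `o, v`, increasing `Ψ ≥ 0`).  ASSUME,
for every `U' ⊆ U`,
 (★)  `Y_{U'}(N)·M_{U'}(∅) ≤ M_{U'}(N)·B_{U'}` for all `N ⊆ U'`
      (i.e. `E[B(C_N); x ∉ C_N] ≤ μ(v ↮ N | v ↮ x)·Cov(Ψ(C_x), 1{v∈C_x})`, COV-TAU-PROOF §3, to be supplied from the
      decision-tree Harris inequality [Gladkov2024, Thm. 3.2] and [VandenbergHaggstromKahn2005, Thm. 1.4]), and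
 (Y↓) `Y_{U'}` antitone in the source set (COV-TAU-PROOF §3, Corollary).
THEN for all `N, N' ⊆ U`:
 (A2)  `E_U(N)·Y_U(N') ≤ M_U(N ∪ N')·X_U(N ∩ N')`.
Proof = strong induction on `U` exactly as [VandenbergHaggstromKahn2005, Thm. 1.1, pp. 3–5] / `BHK2006.core`:
trivial cases; `Z = N ∩ N' = ∅` by (★) and ONE application of `BHK2006.core` (BHK Thm. 1.3 for `C_v` given `v ↮ x`:
`s = v`, `X = {x} ∪ N'`, `Y = {x} ∪ N`, `F = 1`, `G = 1{o ∈ C}`); `Z ≠ ∅` by the star decompositions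
(`CovTau.Ef_step`, `Mf_step`, `Yf_step`, `Xf_step`, file `…CovTauA2Star.lean`), the product law of the neighbour set
(`CovTau.sum_weight_rS`, file `…CovTauA2Push.lean`) and
the Ahlswede–Daykin four functions theorem on the lattice `Set V` (Mathlib `four_functions_theorem_univ`), the
induction hypothesis on `U ∖ Z` being applied to the pair `P̃ = S ∪ ((N∖Z)∖T)`, `P̃' = T ∪ ((N'∖Z)∖S)` with
`P̃ ∩ P̃' = S ∩ T`, `P̃ ∪ P̃' = ((N ∪ N')∖Z) ∪ S ∪ T`.
**Corollary `CovTau.p1_of_star`** — the diagonal `N = N' = {y}`: `E({y})·Y({y}) ≤ M({y})·X({y})`, i.e.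
prim-hp-8's `P1[Ψ] = E_π[(q(W) − τ)·B(W)] ≥ 0` (`W = C_y` given `x ∉ C_y`, `τ = μ(o↔v | v↮x, v↮y)`), the
within-world half of the telescoping proof of COV(τ) (⇒ (S5)₂ ⇒ (GEN) for three relays ⇒ Kozma–Nitzan Conj. 1 for
`|A| = 3`, via `SurplusTransfer.surplusTransfer_pair_of_covTransfer`).
[cite: VandenbergHaggstromKahn2005, Thm. 1.1 (pp. 3–5), Thm. 1.3 (p. 6)] [cite: Gladkov2024, Thm. 3.2]
[cite: KozmaNitzan2024, Conj. 1 (p. 3)]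
-/

noncomputable section

namespace Summit.CriticalPhenomena.PercolationContinuityZ3.Theorems.CovTau

open Literature.Probability.Percolation
open Literature.Probability.Percolation.BHK2006
open Literature.Probability.Percolation.DecisionTree (ind ind_of_mem ind_of_not_mem ind_nonneg)
open scoped Classical

variable {V : Type*} [Fintype V]

/-- **(A2) modulo (★)** — see the module docstring.
[cite: VandenbergHaggstromKahn2005, Thm. 1.1 (pp. 3–5), Thm. 1.3 (p. 6)] [cite: Gladkov2024, Thm. 3.2] -/
theorem a2_of_star (w : Sym2 V → ℝ) (hw0 : ∀ e, 0 ≤ w e) (hw1 : ∀ e, w e ≤ 1)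
    (hm : ∑ ω, weight w ω = 1) (x o v : V) {Ψ : Set V → ℝ}
    (hΨ : ∀ S T : Set V, S ⊆ T → Ψ S ≤ Ψ T) (hΨ0 : ∀ S, 0 ≤ Ψ S) (U : Finset V)
    (hstar : ∀ U' ⊆ U, ∀ N : Set V, N ⊆ ↑U' →
      Yf w U' x v Ψ N * Mf w U' x v ∅ ≤ Mf w U' x v N * Bf w U' x v Ψ)
    (hanti : ∀ U' ⊆ U, ∀ N N' : Set V, N ⊆ N' → N' ⊆ ↑U' → Yf w U' x v Ψ N' ≤ Yf w U' x v Ψ N) :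
    ∀ N N' : Set V, N ⊆ ↑U → N' ⊆ ↑U →
      Ef w U x o v N * Yf w U x v Ψ N' ≤ Mf w U x v (N ∪ N') * Xf w U x o v Ψ (N ∩ N') := by
  induction U using Finset.strongInduction with
  | H U ih =>
  intro N N' hNU hN'U
  have hRHS : 0 ≤ Mf w U x v (N ∪ N') * Xf w U x o v Ψ (N ∩ N') :=
    mul_nonneg (Mf_nonneg hw0 hw1 U x v _) (Xf_nonneg hw0 hw1 hm U x o v hΨ hΨ0 _)
  -- trivial cases
  by_cases hvN : v ∈ insert x N
  · rw [Ef_eq_zero_of_mem w U x o v hvN, zero_mul]; exact hRHS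
  have hvx : v ≠ x := fun h => hvN (h ▸ Set.mem_insert x N)
  have hvN0 : v ∉ N := fun h => hvN (Set.mem_insert_of_mem x h)
  by_cases hxN' : x ∈ N'
  · rw [Yf_eq_zero_of_mem w U x v Ψ hxN', mul_zero]; exact hRHS
  by_cases hvU : v ∈ U
  swap
  · rw [Yf_eq_zero_of_not_mem w hvU hvx, mul_zero]; exact hRHS
  by_cases hxU : x ∈ U
  swap
  · rw [Yf_eq_zero_of_not_mem_owner w hxU hvx, mul_zero]; exact hRHS
  -- `Z := N ∩ N'`
  set Z : Finset V := U.filter fun u => u ∈ N ∧ u ∈ N' with hZ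
  have hZU : Z ⊆ U := Finset.filter_subset _ _
  have hmemZ : ∀ u, u ∈ Z ↔ u ∈ N ∧ u ∈ N' := fun u => by
    simp only [hZ, Finset.mem_filter, and_iff_right_iff_imp]
    exact fun h => hNU h.1
  have hxZ : x ∉ Z := fun h => hxN' ((hmemZ x).1 h).2
  have hvZ : v ∉ Z := fun h => hvN0 ((hmemZ v).1 h).1
  have hZN : (↑Z : Set V) ⊆ N := fun u hu => ((hmemZ u).1 hu).1
  have hZN' : (↑Z : Set V) ⊆ N' := fun u hu => ((hmemZ u).1 hu).2
  have hNN'Z : N ∩ N' = ↑Z := Set.ext fun u => by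
    rw [Finset.mem_coe, hmemZ]; rfl
  rcases Z.eq_empty_or_nonempty with hZe | hZne
  · /- `N ∩ N' = ∅`: (★) for `N'` and BHK Thm 1.3 (`BHK2006.core` with `s = v`, `F = 1`, `G = 1{o ∈ C_v}`). -/
    have hNN' : N ∩ N' = ∅ := by rw [hNN'Z, hZe, Finset.coe_empty]
    rw [hNN', Xf_empty w hm]
    have hst := hstar U le_rfl N' hN'U
    have hcore := core w hw0 hw1 hm U v hvU (insert x N') (insert x N)
      (Set.insert_subset hxU hN'U) (Set.insert_subset hxU hNU) (fun _ => (1 : ℝ)) (oInd o v)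
      monotone_const (oInd_mono o v) (fun _ => zero_le_one) (oInd_nonneg o v)
    have hi : insert x N' ∩ insert x N = insert x (∅ : Set V) := by
      rw [← Set.insert_inter_distrib, Set.inter_comm, hNN']
    have hu : insert x N' ∪ insert x N = insert x (N ∪ N') := by
      rw [← Set.insert_union_distrib, Set.union_comm]
    simp only [one_mul, hi, hu] at hcore
    change Mf w U x v N' * Ef w U x o v N ≤ Ef w U x o v ∅ * Mf w U x v (N ∪ N') at hcore
    have hE := Ef_nonneg hw0 hw1 U x o v N
    have hB := Bf_nonneg hw0 hw1 hm U x v hΨ hΨ0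
    have hM := Mf_nonneg hw0 hw1 U x v (N ∪ N')
    have hM0 := Mf_nonneg hw0 hw1 U x v (∅ : Set V)
    have key : Ef w U x o v N * Yf w U x v Ψ N' * Mf w U x v ∅ ≤
        Mf w U x v (N ∪ N') * (Ef w U x o v ∅ * Bf w U x v Ψ) :=
      calc Ef w U x o v N * Yf w U x v Ψ N' * Mf w U x v ∅
          = Ef w U x o v N * (Yf w U x v Ψ N' * Mf w U x v ∅) := by ring
        _ ≤ Ef w U x o v N * (Mf w U x v N' * Bf w U x v Ψ) := mul_le_mul_of_nonneg_left hst hE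
        _ = (Mf w U x v N' * Ef w U x o v N) * Bf w U x v Ψ := by ring
        _ ≤ (Ef w U x o v ∅ * Mf w U x v (N ∪ N')) * Bf w U x v Ψ := mul_le_mul_of_nonneg_right hcore hB
        _ = _ := by ring
    rcases hM0.eq_or_lt with hM0e | hM0p
    · -- `μ(v ↮ x) = 0`: then `E(N) = 0`
      have hE0 : Ef w U x o v N = 0 := le_antisymm
        ((Ef_le_Mf hw0 hw1 U x o v N).trans
          ((Mf_antitone hw0 hw1 U x v (Set.empty_subset N)).trans hM0e.symm.le)) hE
      rw [hE0, zero_mul]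
      exact mul_nonneg hM (mul_nonneg (qf_nonneg hw0 hw1 U x o v) hB)
    · unfold qf
      calc Ef w U x o v N * Yf w U x v Ψ N'
          = Ef w U x o v N * Yf w U x v Ψ N' * Mf w U x v ∅ / Mf w U x v ∅ := by
            field_simp
        _ ≤ Mf w U x v (N ∪ N') * (Ef w U x o v ∅ * Bf w U x v Ψ) / Mf w U x v ∅ :=
            div_le_div_of_nonneg_right key hM0p.le
        _ = Mf w U x v (N ∪ N') * (Ef w U x o v ∅ / Mf w U x v ∅ * Bf w U x v Ψ) := by
            field_simp
  · /- `Z ≠ ∅`: condition on the neighbour set `S` of `Z`, push forward to its product law, and apply the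
    four functions theorem with the induction hypothesis on `U ∖ Z`. -/
    have hss : U \ Z ⊂ U := Finset.sdiff_ssubset hZU hZne
    have hU'U : U \ Z ⊆ U := Finset.sdiff_subset
    have hZNN' : (↑Z : Set V) ⊆ N ∪ N' := hZN.trans Set.subset_union_left
    -- star decompositions
    have eE := Ef_step hZU hxZ hvZ hZN w hm o
    have eY := Yf_step hZU hxZ hZN' w hm v Ψ
    have eM := Mf_step hZU hxZ hvZ hZNN' w hm
    have eX : Xf w U x o v Ψ (N ∩ N') = ∑ ω, weight w ω * Xf w (U \ Z) x o v Ψ (rS U Z ω) := by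
      rw [hNN'Z, Xf_step hZU hxZ (subset_refl _) w hm o v Ψ]
      simp only [Set.sdiff_self, Set.empty_union]
    -- the four functionals on the lattice `Set V`
    set e : Set V → ℝ := fun η => Ef w (U \ Z) x o v (N \ ↑Z ∪ (η ∩ ↑(U \ Z))) with he
    set y : Set V → ℝ := fun η => Yf w (U \ Z) x v Ψ (N' \ ↑Z ∪ (η ∩ ↑(U \ Z))) with hy
    set m : Set V → ℝ := fun η => Mf w (U \ Z) x v ((N ∪ N') \ ↑Z ∪ (η ∩ ↑(U \ Z))) with hm'
    set χ : Set V → ℝ := fun η => Xf w (U \ Z) x o v Ψ (η ∩ ↑(U \ Z)) with hχ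
    set wp : Set V → ℝ := weight (pZ w U Z) with hwp
    have hrSU : ∀ ω : Set (Sym2 V), rS U Z ω ∩ ↑(U \ Z) = rS U Z ω := fun ω =>
      Set.inter_eq_left.2 (rS_subset U Z ω)
    have hE' : Ef w U x o v N = ∑ η, wp η * e η := by
      rw [eE, ← sum_weight_rS hm U Z e]
      refine Finset.sum_congr rfl fun ω _ => ?_
      simp only [he, hrSU]
    have hY' : Yf w U x v Ψ N' = ∑ η, wp η * y η := by
      rw [eY, ← sum_weight_rS hm U Z y]
      refine Finset.sum_congr rfl fun ω _ => ?_
      simp only [hy, hrSU]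
    have hM' : Mf w U x v (N ∪ N') = ∑ η, wp η * m η := by
      rw [eM, ← sum_weight_rS hm U Z m]
      refine Finset.sum_congr rfl fun ω _ => ?_
      simp only [hm', hrSU]
    have hX' : Xf w U x o v Ψ (N ∩ N') = ∑ η, wp η * χ η := by
      rw [eX, ← sum_weight_rS hm U Z χ]
      refine Finset.sum_congr rfl fun ω _ => ?_
      simp only [hχ, hrSU]
    -- nonnegativity
    have hp0 : ∀ u, 0 ≤ pZ w U Z u := fun u => (pZ_mem hw0 hw1 hm U Z u).1
    have hp1 : ∀ u, pZ w U Z u ≤ 1 := fun u => (pZ_mem hw0 hw1 hm U Z u).2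
    have hwp0 : ∀ η, 0 ≤ wp η := fun η => weight_nonneg hp0 hp1 η
    have he0 : ∀ η, 0 ≤ e η := fun η => Ef_nonneg hw0 hw1 _ x o v _
    have hy0 : ∀ η, 0 ≤ y η := fun η => Yf_nonneg hw0 hw1 hm _ x v hΨ hΨ0 _
    have hm0 : ∀ η, 0 ≤ m η := fun η => Mf_nonneg hw0 hw1 _ x v _
    have hχ0 : ∀ η, 0 ≤ χ η := fun η => Xf_nonneg hw0 hw1 hm _ x o v hΨ hΨ0 _
    -- hypotheses restricted to `(U \ Z)`
    have hstar' : ∀ U'' ⊆ (U \ Z), ∀ N : Set V, N ⊆ ↑U'' →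
        Yf w U'' x v Ψ N * Mf w U'' x v ∅ ≤ Mf w U'' x v N * Bf w U'' x v Ψ :=
      fun U'' hU'' => hstar U'' (hU''.trans hU'U)
    have hanti' : ∀ U'' ⊆ (U \ Z), ∀ N N' : Set V, N ⊆ N' → N' ⊆ ↑U'' → Yf w U'' x v Ψ N' ≤ Yf w U'' x v Ψ N :=
      fun U'' hU'' => hanti U'' (hU''.trans hU'U)
    have IH := ih (U \ Z) hss hstar' hanti'
    have keyZ : ∀ u, u ∈ N → u ∈ N' → u ∈ (↑Z : Set V) := fun u h1 h2 => (hmemZ u).2 ⟨h1, h2⟩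
    rw [hE', hY', hM', hX', mul_comm (∑ η, wp η * m η)]
    refine four_functions_theorem_univ (fun η => wp η * e η) (fun η => wp η * y η)
      (fun η => wp η * χ η) (fun η => wp η * m η)
      (fun η => mul_nonneg (hwp0 η) (he0 η)) (fun η => mul_nonneg (hwp0 η) (hy0 η))
      (fun η => mul_nonneg (hwp0 η) (hχ0 η)) (fun η => mul_nonneg (hwp0 η) (hm0 η)) fun a b => ?_
    -- the Ahlswede–Daykin hypothesis from the induction hypothesis at the pair `(P̃, P̃')`
    set S' : Set V := a ∩ ↑(U \ Z) with hS'
    set T' : Set V := b ∩ ↑(U \ Z) with hT'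
    set P : Set V := S' ∪ (N \ ↑Z) \ T' with hP
    set P' : Set V := T' ∪ (N' \ ↑Z) \ S' with hP'
    have hPU : P ⊆ ↑(U \ Z) := by
      rintro u (hu | ⟨⟨huN, huZ⟩, -⟩)
      · exact hu.2
      · rw [Finset.coe_sdiff]; exact ⟨hNU huN, huZ⟩
    have hP'U : P' ⊆ ↑(U \ Z) := by
      rintro u (hu | ⟨⟨huN, huZ⟩, -⟩)
      · exact hu.2
      · rw [Finset.coe_sdiff]; exact ⟨hN'U huN, huZ⟩
    have hIH := IH P P' hPU hP'U
    have h1 : e a ≤ Ef w (U \ Z) x o v P :=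
      Ef_antitone hw0 hw1 (U \ Z) x o v (show P ⊆ N \ ↑Z ∪ S' from by
        rintro u (hu | ⟨hu, -⟩); exacts [Or.inr hu, Or.inl hu])
    have h2 : y b ≤ Yf w (U \ Z) x v Ψ P' :=
      hanti (U \ Z) hU'U P' (N' \ ↑Z ∪ T') (by rintro u (hu | ⟨hu, -⟩); exacts [Or.inr hu, Or.inl hu])
        (by
          rintro u (⟨huN, huZ⟩ | hu)
          · rw [Finset.coe_sdiff]; exact ⟨hN'U huN, huZ⟩
          · exact hu.2)
    have hunion : P ∪ P' = (N ∪ N') \ ↑Z ∪ ((a ∪ b) ∩ ↑(U \ Z)) := by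
      ext u
      constructor
      · rintro ((hS | ⟨hA, -⟩) | (hT | ⟨hA', -⟩))
        · exact Or.inr ⟨Or.inl hS.1, hS.2⟩
        · exact Or.inl ⟨Or.inl hA.1, hA.2⟩
        · exact Or.inr ⟨Or.inr hT.1, hT.2⟩
        · exact Or.inl ⟨Or.inr hA'.1, hA'.2⟩
      · rintro (⟨hN | hN', hZ'⟩ | ⟨ha | hb, hU⟩)
        · by_cases hT : u ∈ T'
          · exact Or.inr (Or.inl hT)
          · exact Or.inl (Or.inr ⟨⟨hN, hZ'⟩, hT⟩)
        · by_cases hS : u ∈ S'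
          · exact Or.inl (Or.inl hS)
          · exact Or.inr (Or.inr ⟨⟨hN', hZ'⟩, hS⟩)
        · exact Or.inl (Or.inl ⟨ha, hU⟩)
        · exact Or.inr (Or.inl ⟨hb, hU⟩)
    have hinter : P ∩ P' = (a ∩ b) ∩ ↑(U \ Z) := by
      ext u
      constructor
      · rintro ⟨hS | ⟨⟨hN, hZ'⟩, hT⟩, hT' | ⟨⟨hN', -⟩, hS'⟩⟩
        · exact ⟨⟨hS.1, hT'.1⟩, hS.2⟩
        · exact absurd hS hS'
        · exact absurd hT' hT
        · exact absurd (keyZ u hN hN') hZ'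
      · rintro ⟨⟨ha, hb⟩, hU⟩
        exact ⟨Or.inl ⟨ha, hU⟩, Or.inl ⟨hb, hU⟩⟩
    have h3 : e a * y b ≤ m (a ∪ b) * χ (a ∩ b) :=
      calc e a * y b ≤ Ef w (U \ Z) x o v P * Yf w (U \ Z) x v Ψ P' :=
            mul_le_mul h1 h2 (hy0 b) (Ef_nonneg hw0 hw1 _ x o v _)
        _ ≤ Mf w (U \ Z) x v (P ∪ P') * Xf w (U \ Z) x o v Ψ (P ∩ P') := hIH
        _ = m (a ∪ b) * χ (a ∩ b) := by rw [hunion, hinter]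
    have hwab := weight_inter_mul_union (pZ w U Z) a b
    show wp a * e a * (wp b * y b) ≤ wp (a ∩ b) * χ (a ∩ b) * (wp (a ∪ b) * m (a ∪ b))
    calc wp a * e a * (wp b * y b) = (wp a * wp b) * (e a * y b) := by ring
      _ ≤ (wp (a ∩ b) * wp (a ∪ b)) * (m (a ∪ b) * χ (a ∩ b)) := by
          rw [hwp, hwab]
          exact mul_le_mul_of_nonneg_left h3 (mul_nonneg (hwp0 _) (hwp0 _))
      _ = _ := by ring

/-- **P1 ≥ 0 modulo (★)** — the diagonal `N = N' = {y}` of (A2): `E({y})·Y({y}) ≤ M({y})·X({y})`, i.e.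
`E_π[(q(C_y) − τ)·B(C_y)] ≥ 0` with `τ = μ(o↔v | v↮x, v↮y)` (COV-TAU-PROOF §5(a)).
[cite: VandenbergHaggstromKahn2005, Thm. 1.1 (pp. 3–5)] [cite: Gladkov2024, Thm. 3.2] -/
theorem p1_of_star (w : Sym2 V → ℝ) (hw0 : ∀ e, 0 ≤ w e) (hw1 : ∀ e, w e ≤ 1)
    (hm : ∑ ω, weight w ω = 1) (x o v y : V) {Ψ : Set V → ℝ}
    (hΨ : ∀ S T : Set V, S ⊆ T → Ψ S ≤ Ψ T) (hΨ0 : ∀ S, 0 ≤ Ψ S) (U : Finset V) (hy : y ∈ U)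
    (hstar : ∀ U' ⊆ U, ∀ N : Set V, N ⊆ ↑U' →
      Yf w U' x v Ψ N * Mf w U' x v ∅ ≤ Mf w U' x v N * Bf w U' x v Ψ)
    (hanti : ∀ U' ⊆ U, ∀ N N' : Set V, N ⊆ N' → N' ⊆ ↑U' → Yf w U' x v Ψ N' ≤ Yf w U' x v Ψ N) :
    Ef w U x o v {y} * Yf w U x v Ψ {y} ≤ Mf w U x v {y} * Xf w U x o v Ψ {y} := by
  have h := a2_of_star w hw0 hw1 hm x o v hΨ hΨ0 U hstar hanti {y} {y}
    (Set.singleton_subset_iff.2 hy) (Set.singleton_subset_iff.2 hy)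
  simpa only [Set.union_self, Set.inter_self] using h

end Summit.CriticalPhenomena.PercolationContinuityZ3.Theorems.CovTau
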